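import Summits.NavierStokesRegularity.NavierStokesRegularity.Theorems.StretchingWellBindingEnstrophyQuarterLawWeakTraceAssembly
import Summits.NavierStokesRegularity.NavierStokesRegularity.Theorems.StretchingWellBindingEnstrophyQuarterLawTraceTransfer
import HarnessLib

/-!
# Shelf 1574: the terminal slice of a quarter-law blow-up is an EXACTLY CRITICAL scar
# (weak-`L³` on `ℝ³`, locally `L³` at NO singular point)

Portrait file (`--supports stmt-NavierStokesRegularity-1574 --as helper`) joining the two landed trace lines
of the crux `EnstrophyQuarterLaw` (stmt-NavierStokesRegularity-1574):

* LINE 9 «trace_transfer» (`TraceTransfer.not_memLp_three_of_sliceLaw_of_backwardSingular`, p-landed): along a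
  classical Leray–Hopf solution from a rapidly decaying datum with Leray's slice law
  `∫|curl u(t)|² ≤ K/√(T−t)` on `[0,T)`, the terminal slice `u(T)` is in `L³` of NO ball around a
  backward-singular vertex `(T, x₀)`;
* its weak-`L³` twin «weak_trace» (`WeakTrace.weakL3_terminal_of_sliceLaw`, this seat): along a MAXIMAL such
  solution the slice law puts `u(T)` in `L^{3,∞}(ℝ³)`.

Together (`terminal_portrait_of_sliceLaw`): per blow-up, the slice law pins the terminal profile between the
two critical spaces — `u(T) ∈ L^{3,∞}(ℝ³) \ L³_loc` at some point (a maximal solution has a backward-singular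
vertex by the landed `terminalTrace_blowupHasSingularPoint_proof`), i.e. an `|x − x₀|⁻¹`-STRENGTH scar, no
weaker (it is not `L³`) and no stronger (it is weak-`L³`). By name (`terminal_portrait_of_enstrophyQuarterLaw`):
`EnstrophyQuarterLaw ⟹` every first blow-up of the route's class ends in such a scar.

HONEST FRAMING: a two-line composition of landed theorems along HYPOTHETICAL blow-ups; conditional on the
OPEN shelf crux in its by-name form; `EnstrophyQuarterLaw` (1574) and NS regularity stay OPEN; no registered
stub of `Lines/sparse_sieve.lean` is touched; nothing here proves a summit. [folklore]
-/

noncomputable section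

-- the summit-side namespace repeats a component by design (D-0017)
set_option linter.dupNamespace false

namespace Summit.NavierStokesRegularity.NavierStokesRegularity.Theorems.EnstrophyQuarterLaw.WeakTrace

open Set MeasureTheory Function Metric Filter Topology
open scoped ENNReal NNReal
open Literature.Analysis.FluidPDE Literature.Analysis.FunctionSpaces

variable {ν T : ℝ} {u : ℝ → EuclideanSpace ℝ (Fin 3) → EuclideanSpace ℝ (Fin 3)}
  {p : ℝ → EuclideanSpace ℝ (Fin 3) → ℝ}

/-- **Terminal portrait of a quarter-law blow-up (per solution).** For a maximal classical Leray–Hopf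
solution from a rapidly decaying datum (`ν, T > 0`) obeying Leray's slice law `∫|curl u(t)|² ≤ K/√(T−t)` on
`[0,T)`: the terminal slice is weak-`L³` on `ℝ³` AND fails to be `L³` on every ball around some point.
[folklore] -/
theorem terminal_portrait_of_sliceLaw (hν : 0 < ν) (hT : 0 < T)
    (hmax : IsMaximalSmoothSolution ν 0 u p T) (hLH : IsLerayHopfOn T ν 0 (u 0) u)
    (hdec : HasRapidSpatialDecay (u 0)) {K : ℝ}
    (hK : ∀ t ∈ Ico 0 T, ∫⁻ x, ‖curl (u t) x‖ₑ ^ 2 ≤ ENNReal.ofReal (K / Real.sqrt (T - t))) :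
    eWeakLpPow (u T) 3 volume < ⊤ ∧
      ∃ x₀ : EuclideanSpace ℝ (Fin 3), ∀ ρ : ℝ, 0 < ρ → ¬ MemLp (u T) 3 (volume.restrict (ball x₀ ρ)) := by
  refine ⟨weakL3_terminal_of_sliceLaw hν hT hmax hLH hdec hK, ?_⟩
  obtain ⟨x₀, hx₀⟩ :=
    Theorems.terminalTrace_blowupHasSingularPoint_proof ν T hν hT u p hmax.1 hLH hdec hmax.2
  exact ⟨x₀, fun ρ hρ =>
    TraceTransfer.not_memLp_three_of_sliceLaw_of_backwardSingular hν hT hmax.1 hLH hdec hK hx₀ hρ⟩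

/-- **At every backward-singular vertex the scar is exactly critical (per solution)**: under the slice law,
`u(T) ∈ L^{3,∞}(ℝ³)` while `u(T) ∉ L³(B(x₀, ρ))` for every `ρ > 0` at any vertex `(T, x₀)` where `u` is
essentially unbounded on all backward parabolic cylinders. [folklore] -/
theorem exactlyCriticalScar_of_sliceLaw (hν : 0 < ν) (hT : 0 < T)
    (hmax : IsMaximalSmoothSolution ν 0 u p T) (hLH : IsLerayHopfOn T ν 0 (u 0) u)
    (hdec : HasRapidSpatialDecay (u 0)) {K : ℝ}
    (hK : ∀ t ∈ Ico 0 T, ∫⁻ x, ‖curl (u t) x‖ₑ ^ 2 ≤ ENNReal.ofReal (K / Real.sqrt (T - t)))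
    {x₀ : EuclideanSpace ℝ (Fin 3)}
    (hsing : ∀ r : ℝ, 0 < r → eLpNorm (uncurry u) ⊤ (volume.restrict (parabolicCylinder r (T, x₀))) = ⊤)
    {ρ : ℝ} (hρ : 0 < ρ) :
    eWeakLpPow (u T) 3 volume < ⊤ ∧ ¬ MemLp (u T) 3 (volume.restrict (ball x₀ ρ)) :=
  ⟨weakL3_terminal_of_sliceLaw hν hT hmax hLH hdec hK,
    TraceTransfer.not_memLp_three_of_sliceLaw_of_backwardSingular hν hT hmax.1 hLH hdec hK hsing hρ⟩

/-- **`EnstrophyQuarterLaw ⟹` every first blow-up of the route's class ends in an exactly critical scar** (by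
name, conditional on the OPEN shelf crux): the terminal slice is weak-`L³` on `ℝ³` and is `L³` on no ball
around some point. [folklore] -/
theorem terminal_portrait_of_enstrophyQuarterLaw (hQ : Theses.StretchingWellBinding.EnstrophyQuarterLaw) :
    ∀ (ν T : ℝ), 0 < ν → 0 < T →
      ∀ (u : ℝ → EuclideanSpace ℝ (Fin 3) → EuclideanSpace ℝ (Fin 3)) (p : ℝ → EuclideanSpace ℝ (Fin 3) → ℝ),
        IsMaximalSmoothSolution ν 0 u p T → IsLerayHopfOn T ν 0 (u 0) u → HasRapidSpatialDecay (u 0) →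
        eWeakLpPow (u T) 3 volume < ⊤ ∧
          ∃ x₀ : EuclideanSpace ℝ (Fin 3), ∀ ρ : ℝ, 0 < ρ → ¬ MemLp (u T) 3 (volume.restrict (ball x₀ ρ)) := by
  intro ν T hν hT u p hmax hLH hdec
  obtain ⟨K, hK⟩ := hQ ν T hν hT u p hmax hLH hdec
  exact terminal_portrait_of_sliceLaw hν hT hmax hLH hdec hK

end Summit.NavierStokesRegularity.NavierStokesRegularity.Theorems.EnstrophyQuarterLaw.WeakTrace

end
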